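import Mathlib
import HarnessLib
import Summits.ValiantsHypothesis.ValiantsHypothesis.Theses.MonotoneRestoration
import Literature.Computability.AlgebraicComplexity.ArithCircuit
import Literature.Computability.AlgebraicComplexity.ArithCircuitProofs
import Literature.Computability.AlgebraicComplexity.MonotoneStructure
import Literature.Computability.AlgebraicComplexity.PermanentIrreducible
import Literature.ModelTheory.FiniteModelTheory.CkEquiv
import Summits.ValiantsHypothesis.ValiantsHypothesis.Theorems.MonotoneRestorationMonotoneRestorationQPCosetCount
import Summits.ValiantsHypothesis.ValiantsHypothesis.Theorems.MonotoneRestorationMonotoneRestorationQPSymmetricLB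
import Summits.ValiantsHypothesis.ValiantsHypothesis.Theorems.MonotoneRestorationMonotoneRestorationQPSupportSymmetrisation
import Summits.ValiantsHypothesis.ValiantsHypothesis.Theorems.MonotoneRestorationMonotoneRestorationQPSparseRegime
import Summits.ValiantsHypothesis.ValiantsHypothesis.Theorems.MonotoneRestorationMonotoneRestorationQPBeta
import Literature.Computability.AlgebraicComplexity.SymmetricArithCircuit
import Literature.Computability.AlgebraicComplexity.DawarWilsenach2025Proofs
import Literature.GroupTheory.PermutationGroups.SmallIndexSubgroups
import Summits.ValiantsHypothesis.ValiantsHypothesis.Theorems.MonotoneRestorationQP.Negative.LoadBearing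
import Summits.ValiantsHypothesis.ValiantsHypothesis.Theorems.MonotoneRestorationMonotoneRestorationQPPermSupportCount

/-! TTRL-lite variant V19142 of stmt-ValiantsHypothesis-15886 -/

-- `Summit.ValiantsHypothesis.ValiantsHypothesis.…` is the tree's mandated single-conjunct layout
-- (Sub = Summit), so the duplicated namespace component is intended.
set_option linter.dupNamespace false

namespace Summit.ValiantsHypothesis.ValiantsHypothesis.Theorems

open Summit.ValiantsHypothesis.ValiantsHypothesis.Theses.MonotoneRestoration
open Literature.Computability.AlgebraicComplexity

/-- `S_n × S_n` invariance of the row-sum substitution of the elementary symmetric polynomial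
`e_k`, for arbitrary `k`: renaming rows by `σ` and columns by `τ` in
`bind₁ (fun i => ∑ j, X (i, j)) (esymm (Fin n) ℝ≥0 k)` leaves it unchanged. The column
permutation `τ` is absorbed by reindexing each row sum (`Equiv.sum_comp`), and the row
permutation `σ` by the symmetry of `esymm` (`MvPolynomial.rename_esymm`). -/
theorem stub_esymmRowSums_structure_var19142 :
    ∀ (n k : ℕ) (σ τ : Equiv.Perm (Fin n)),
      MvPolynomial.rename (fun p : Fin n × Fin n => (σ p.1, τ p.2))
        (MvPolynomial.bind₁ (fun i : Fin n => ∑ j : Fin n, MvPolynomial.X (i, j))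
          (MvPolynomial.esymm (Fin n) NNReal k)) =
      MvPolynomial.bind₁ (fun i : Fin n => ∑ j : Fin n, MvPolynomial.X (i, j))
        (MvPolynomial.esymm (Fin n) NNReal k) := by
  intro n k σ τ
  have h :
      (fun i : Fin n =>
          MvPolynomial.rename (fun q : Fin n × Fin n => (σ q.1, τ q.2))
            (∑ j : Fin n, (MvPolynomial.X (i, j) : MvPolynomial (Fin n × Fin n) NNReal))) =
        (fun i : Fin n =>
            ∑ j : Fin n, (MvPolynomial.X (i, j) : MvPolynomial (Fin n × Fin n) NNReal)) ∘ σ := by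
    funext i
    simp only [Function.comp_apply, map_sum, MvPolynomial.rename_X]
    exact Equiv.sum_comp τ
      (fun j => (MvPolynomial.X (σ i, j) : MvPolynomial (Fin n × Fin n) NNReal))
  rw [MvPolynomial.rename_bind₁, h, ← MvPolynomial.bind₁_rename, MvPolynomial.rename_esymm]

end Summit.ValiantsHypothesis.ValiantsHypothesis.Theorems
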